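import Mathlib
import HarnessLib
import Summits.Ventures.LatticeQCDFlow.Scoring.DoeblinAutocorrelation
import Summits.Ventures.LatticeQCDFlow.Scoring.VarianceOfTheMean

/-!
# THE BRIDGE: `autocov κ π f t` is the two-time moment of the simulated chain, and the fitness is the
# variance of its time average — `Var[(1/N) Σ_{i<N} f(X_i)] = 2 τ_N(ρ_f) Var_π f / N`

HONEST FRAMING: exact (Metropolis-corrected) sampling algorithms for lattice gauge theory;
figures of merit are autocorrelation/cost numbers at stated couplings and volumes; no
continuum-physics claim.

Venture `LatticeQCDFlow` (cell pub-lqcd), topic `Scoring`; FANOUT row 8 (`s0-cpn-nemc`, GEN-12).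
NEW WORK of the cell, not a published result; no definition is introduced.  Every kernel-level
autocorrelation theorem of the tree (`Scoring/KernelTransitionOperator.lean` and its descendants)
is phrased with the operator form `autocov κ π f t = ∫ f · (kop κ)^[t] f dπ`; row 11's
`Scoring/VarianceOfTheMean.lean` proves `Var[(1/N) Σ Xᵢ] = 2 τ_N σ²/N` for any random variables with
lag-only covariances.  This file closes the gap with Mathlib's Ionescu-Tulcea construction
(`ProbabilityTheory.Kernel.trajMeasure`, `Kernel.traj`, `partialTraj`): the law `P` on `ℕ → Ω` of
the homogeneous Markov chain with kernel `κ` (the family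
`n ↦ κ.comap (fun h : (Π i : Iic n, Ω) ↦ h n)`) started in a probability law.  Printed counterpart
NAMED ONLY: the Markov property / Chapman–Kolmogorov for the canonical chain (Meyn–Tweedie 1993
Ch. 3; Kallenberg 2021 Thm 8.24 for the construction, which is Mathlib's).

## Content (`κ` Markov; `P = trajMeasure μ₀ (n ↦ κ ∘ eval n)`; observables bounded measurable)

* **`chain_tower`** — `E_P[F(X_{≤a}) g(X_{a+1})] = E_P[F(X_{≤a}) (kop κ g)(X_a)]` for every bounded
  measurable functional `F` of the history (Mathlib's
  `map_frestrictLe_trajMeasure_compProd_eq_map_trajMeasure` integrated);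
* **`chain_twoTime`** — `E_P[f(X_s) g(X_{s+t})] = E_P[f(X_s) ((kop κ)^[t] g)(X_s)]` (induction on `t`);
* **`chain_marginal`** — started in an INVARIANT law `π`, every one-time marginal is `π`:
  `E_P[f(X_s)] = ∫ f dπ` (time `0` from the construction, then invariance step by step);
* **`chain_twoTime_eq_integral`**, **`chain_autocov`** — THE BRIDGE:
  `E_P[g(X_s) f(X_{s+t})] = ∫ g · (kop κ)^[t] f dπ`, `E_P[f(X_s) f(X_{s+t})] = autocov κ π f t`;
* **`chain_covariance`** — `cov[f(X_i), f(X_j); P] = autocov κ π (f − π f) |i − j|` (Mathlib's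
  `ProbabilityTheory.covariance`); `chain_memLp`;
* **`variance_timeAverage`** — for `Var_π f ≠ 0` and `N ≥ 1`:
  `Var_P[(1/N) Σ_{i<N} f(X_i)] = 2 τ_N(ρ_f) · Var_π f / N` with `ρ_f(t) = autocov κ π (f − πf) t / Var_π f`
  the TRUE autocorrelation function and `τ_N` row 11's finite-`N` integrated autocorrelation time
  (`Scoring.tauIntN`; `τ_N → τ_int`, `Scoring/VarianceOfTheMean`, `Scoring/DoeblinGreenKubo`) — the
  scorers' convention `n_eff = N/(2τ)` is a THEOREM about the simulated chain;
* **`variance_timeAverage_le_of_doeblin`** — A CERTIFIED NON-ASYMPTOTIC ERROR BAR: if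
  `κ(x, ·) ≥ ε π` (`ε > 0`) then for every bounded measurable `f` and every `N ≥ 1`,
  `Var_P[(1/N) Σ_{i<N} f(X_i)] ≤ (2/ε − 1) · Var_π f / N` (no `Var_π f ≠ 0` needed) — with the tree's
  exact flow-MCMC theorem (`ε = e^{−2δ}`, `Exactness.flowSampler_exact_doeblin`) this reads
  `≤ (2e^{2δ} − 1) Var_π f / N` for the exact flow sampler at every volume at which `δ` holds.

So every `τ_int` ceiling / floor / bracket of the `Scoring/*` files is, through this file, a
statement about the mean-square error of the time average of the chain a seat actually simulates.
NOT CLAIMED: any number of ours; the estimator of `τ` (Γ-method windowing) — these are statements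
about the TRUE variance; non-stationary starts (the chain is started in `π`).
-/

noncomputable section

namespace Summit.Ventures.LatticeQCDFlow.Scoring

open MeasureTheory ProbabilityTheory Filter Finset Preorder
open scoped ENNReal

variable {Ω : Type*} [MeasurableSpace Ω]

section Chain

variable (κ : Kernel Ω Ω) [IsMarkovKernel κ] (μ₀ : Measure Ω) [IsProbabilityMeasure μ₀]

/-! ### The Markov property on observables -/

/-- **Tower property along the chain**: for bounded measurable `F` of the history up to time `a`
and bounded measurable `g`: `E[F(X_{≤a}) g(X_{a+1})] = E[F(X_{≤a}) (kop κ g)(X_a)]`. -/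
theorem chain_tower (a : ℕ) {F : ((i : ↥(Finset.Iic a)) → Ω) → ℝ} (hF : Measurable F) {CF : ℝ}
    (hCF : ∀ h, |F h| ≤ CF) {g : Ω → ℝ} (hg : Measurable g) {Cg : ℝ} (hCg : ∀ x, |g x| ≤ Cg) :
    ∫ x, F (frestrictLe a x) * g (x (a + 1)) ∂(Kernel.trajMeasure (X := fun _ : ℕ => Ω) μ₀
        (fun n : ℕ => κ.comap (fun h : (i : ↥(Finset.Iic n)) → Ω => h ⟨n, Finset.mem_Iic.2 le_rfl⟩)
          (measurable_pi_apply _)))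
      = ∫ x, F (frestrictLe a x) * kop κ g (x a) ∂(Kernel.trajMeasure (X := fun _ : ℕ => Ω) μ₀
        (fun n : ℕ => κ.comap (fun h : (i : ↥(Finset.Iic n)) → Ω => h ⟨n, Finset.mem_Iic.2 le_rfl⟩)
          (measurable_pi_apply _))) := by
  set P := Kernel.trajMeasure (X := fun _ : ℕ => Ω) μ₀
        (fun n : ℕ => κ.comap (fun h : (i : ↥(Finset.Iic n)) → Ω => h ⟨n, Finset.mem_Iic.2 le_rfl⟩)
          (measurable_pi_apply _)) with hP
  have hcp := Kernel.map_frestrictLe_trajMeasure_compProd_eq_map_trajMeasure (X := fun _ : ℕ => Ω) (μ₀ := μ₀)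
    (κ := fun n : ℕ => κ.comap (fun h : (i : ↥(Finset.Iic n)) → Ω => h ⟨n, Finset.mem_Iic.2 le_rfl⟩)
      (measurable_pi_apply _)) (a := a)
  rw [← hP] at hcp
  have hmeas : Measurable fun x : ℕ → Ω => (frestrictLe a x, x (a + 1)) :=
    (measurable_frestrictLe a).prodMk (measurable_pi_apply _)
  have hφ : Measurable fun p : ((i : ↥(Finset.Iic a)) → Ω) × Ω => F p.1 * g p.2 :=
    (hF.comp measurable_fst).mul (hg.comp measurable_snd)
  have hψ : Measurable fun p : ((i : ↥(Finset.Iic a)) → Ω) × Ω => F p.1 * kop κ g p.2 :=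
    (hF.comp measurable_fst).mul ((measurable_kop κ hg).comp measurable_snd)
  -- left side as an integral over the joint law of (history, next point)
  have hL : ∫ x, F (frestrictLe a x) * g (x (a + 1)) ∂P
      = ∫ p, F p.1 * g p.2 ∂(P.map fun x => (frestrictLe a x, x (a + 1))) := by
    rw [integral_map hmeas.aemeasurable hφ.aestronglyMeasurable]
  have hR : ∫ x, F (frestrictLe a x) * kop κ g (x a) ∂P
      = ∫ p, F p * kop κ g (p ⟨a, Finset.mem_Iic.2 le_rfl⟩) ∂(P.map (frestrictLe a)) := by
    rw [integral_map (measurable_frestrictLe a).aemeasurable]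
    · rfl
    · exact ((hF.mul ((measurable_kop κ hg).comp (measurable_pi_apply _)))).aestronglyMeasurable
  rw [hL, hR, ← hcp, Measure.integral_compProd]
  · refine integral_congr_ae (ae_of_all _ fun p => ?_)
    show ∫ y, F p * g y ∂((κ.comap (fun h : (i : ↥(Finset.Iic a)) → Ω =>
        h ⟨a, Finset.mem_Iic.2 le_rfl⟩) (measurable_pi_apply _)) p) = F p * kop κ g (p ⟨a, _⟩)
    rw [Kernel.comap_apply, integral_const_mul]
    rfl
  · exact integrable_of_bounded _ hφ (C := CF * Cg) fun p => by
      rw [abs_mul]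
      exact mul_le_mul (hCF p.1) (hCg p.2) (abs_nonneg _) ((abs_nonneg _).trans (hCF p.1))


/-- **Two-time law along the chain**: `E[f(X_s) g(X_{s+t})] = E[f(X_s) ((kop κ)^[t] g)(X_s)]`. -/
theorem chain_twoTime (s : ℕ) {f : Ω → ℝ} (hf : Measurable f) {Cf : ℝ} (hCf : ∀ x, |f x| ≤ Cf) :
    ∀ (t : ℕ) {g : Ω → ℝ}, Measurable g → ∀ {Cg : ℝ}, (∀ x, |g x| ≤ Cg) →
    ∫ x, f (x s) * g (x (s + t)) ∂(Kernel.trajMeasure (X := fun _ : ℕ => Ω) μ₀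
        (fun n : ℕ => κ.comap (fun h : (i : ↥(Finset.Iic n)) → Ω => h ⟨n, Finset.mem_Iic.2 le_rfl⟩)
          (measurable_pi_apply _)))
      = ∫ x, f (x s) * (kop κ)^[t] g (x s) ∂(Kernel.trajMeasure (X := fun _ : ℕ => Ω) μ₀
        (fun n : ℕ => κ.comap (fun h : (i : ↥(Finset.Iic n)) → Ω => h ⟨n, Finset.mem_Iic.2 le_rfl⟩)
          (measurable_pi_apply _)))
  | 0, g, _, _, _ => by simp only [Nat.add_zero, Function.iterate_zero, id]
  | t + 1, g, hg, Cg, hCg => by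
    have key := chain_tower κ μ₀ (s + t)
      (F := fun h : (i : ↥(Finset.Iic (s + t))) → Ω => f (h ⟨s, Finset.mem_Iic.2 (Nat.le_add_right s t)⟩))
      (hf.comp (measurable_pi_apply _)) (fun h => hCf _) hg hCg
    simp only [frestrictLe_apply] at key
    rw [← add_assoc, key, chain_twoTime s hf hCf t (measurable_kop κ hg) (abs_kop_le κ hCg),
      Function.iterate_succ_apply]

variable {κ μ₀}

/-- **One-time marginals are `π`** when the chain is started in its invariant law:
`E[f(X_s)] = ∫ f dπ` for every `s` and bounded measurable `f`. -/
theorem chain_marginal {π : Measure Ω} [IsProbabilityMeasure π] (hπ : Kernel.Invariant κ π) :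
    ∀ (s : ℕ) {f : Ω → ℝ}, Measurable f → ∀ {C : ℝ}, (∀ x, |f x| ≤ C) →
    ∫ x, f (x s) ∂(Kernel.trajMeasure (X := fun _ : ℕ => Ω) π
        (fun n : ℕ => κ.comap (fun h : (i : ↥(Finset.Iic n)) → Ω => h ⟨n, Finset.mem_Iic.2 le_rfl⟩)
          (measurable_pi_apply _)))
      = ∫ x, f x ∂π
  | 0, f, hf, C, hC => by
    -- the time-0 marginal of the trajectory measure is the initial law
    set P := Kernel.trajMeasure (X := fun _ : ℕ => Ω) π
        (fun n : ℕ => κ.comap (fun h : (i : ↥(Finset.Iic n)) → Ω => h ⟨n, Finset.mem_Iic.2 le_rfl⟩)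
          (measurable_pi_apply _)) with hP
    have h0 : (0 : ℕ) ∈ Finset.Iic 0 := Finset.mem_Iic.2 le_rfl
    have hmap : P.map (frestrictLe 0)
        = π.map (MeasurableEquiv.piUnique (fun i : ↥(Finset.Iic 0) => Ω)).symm := by
      rw [hP, Kernel.trajMeasure, Measure.map_comp _ _ (measurable_frestrictLe 0),
        Kernel.traj_map_frestrictLe_of_le le_rfl, Measure.deterministic_comp_eq_map]
      ext S hS
      rw [Measure.map_apply (measurable_frestrictLe₂ _) hS]
      congr 1
    have hFm : Measurable fun h : (i : ↥(Finset.Iic 0)) → Ω => f (h ⟨0, h0⟩) :=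
      hf.comp (measurable_pi_apply _)
    calc ∫ x, f (x 0) ∂P = ∫ h, f (h ⟨0, h0⟩) ∂(P.map (frestrictLe 0)) := by
          rw [integral_map (measurable_frestrictLe 0).aemeasurable hFm.aestronglyMeasurable]
          rfl
      _ = ∫ z, f z ∂π := by
          rw [hmap, integral_map (MeasurableEquiv.measurable _).aemeasurable hFm.aestronglyMeasurable]
          refine integral_congr_ae (ae_of_all _ fun z => ?_)
          show f ((MeasurableEquiv.piUnique (fun i : ↥(Finset.Iic 0) => Ω)).symm z ⟨0, h0⟩) = f z
          rw [MeasurableEquiv.piUnique_symm_apply,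
            Unique.eq_default (⟨0, h0⟩ : ↥(Finset.Iic 0)), uniqueElim_default]
  | s + 1, f, hf, C, hC => by
    have key := chain_tower κ π s (F := fun _ => (1 : ℝ)) measurable_const (CF := 1)
      (fun _ => by simp) hf hC
    simp only [one_mul] at key
    rw [key, chain_marginal hπ s (measurable_kop κ hf) (abs_kop_le κ hC), integral_kop κ hπ hf hC]

/-- **THE BRIDGE: `autocov` is the chain's two-time moment.**  For the Markov chain with kernel `κ`
started in an invariant probability law `π` (Mathlib's `Kernel.trajMeasure`), every pair of bounded
measurable observables and all times `s, t`:
`E[g(X_s) f(X_{s+t})] = ∫ g · (kop κ)^[t] f dπ`; in particular `E[f(X_s) f(X_{s+t})] = autocov κ π f t`. -/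
theorem chain_twoTime_eq_integral {π : Measure Ω} [IsProbabilityMeasure π] (hπ : Kernel.Invariant κ π)
    {f g : Ω → ℝ} (hf : Measurable f) {Cf : ℝ} (hCf : ∀ x, |f x| ≤ Cf) (hg : Measurable g) {Cg : ℝ}
    (hCg : ∀ x, |g x| ≤ Cg) (s t : ℕ) :
    ∫ x, g (x s) * f (x (s + t)) ∂(Kernel.trajMeasure (X := fun _ : ℕ => Ω) π
        (fun n : ℕ => κ.comap (fun h : (i : ↥(Finset.Iic n)) → Ω => h ⟨n, Finset.mem_Iic.2 le_rfl⟩)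
          (measurable_pi_apply _)))
      = ∫ y, g y * (kop κ)^[t] f y ∂π := by
  obtain ⟨hm, hb⟩ := iterate_kop_bounded_measurable κ hf hCf t
  rw [chain_twoTime κ π s hg hCg t hf hCf]
  exact chain_marginal hπ s (show Measurable (fun y => g y * (kop κ)^[t] f y) from hg.mul hm)
    (C := Cg * Cf) fun x => by
      rw [abs_mul]; exact mul_le_mul (hCg x) (hb x) (abs_nonneg _) ((abs_nonneg _).trans (hCg x))

/-- `E[f(X_s) f(X_{s+t})] = autocov κ π f t` for the stationary chain. -/
theorem chain_autocov {π : Measure Ω} [IsProbabilityMeasure π] (hπ : Kernel.Invariant κ π)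
    {f : Ω → ℝ} (hf : Measurable f) {C : ℝ} (hC : ∀ x, |f x| ≤ C) (s t : ℕ) :
    ∫ x, f (x s) * f (x (s + t)) ∂(Kernel.trajMeasure (X := fun _ : ℕ => Ω) π
        (fun n : ℕ => κ.comap (fun h : (i : ↥(Finset.Iic n)) → Ω => h ⟨n, Finset.mem_Iic.2 le_rfl⟩)
          (measurable_pi_apply _)))
      = autocov κ π f t :=
  chain_twoTime_eq_integral hπ hf hC hf hC s t


/-! ### Covariances and the variance of the time average -/

/-- **Lag-only covariances**: for the stationary chain,
`cov[f(X_i), f(X_j)] = autocov κ π (f − π(f)) |i − j|`. -/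
theorem chain_covariance {π : Measure Ω} [IsProbabilityMeasure π] (hπ : Kernel.Invariant κ π)
    {f : Ω → ℝ} (hf : Measurable f) {C : ℝ} (hC : ∀ x, |f x| ≤ C) (i j : ℕ) :
    cov[fun x : ℕ → Ω => f (x i), fun x : ℕ → Ω => f (x j);
        Kernel.trajMeasure (X := fun _ : ℕ => Ω) π
          (fun n : ℕ => κ.comap (fun h : (i : ↥(Finset.Iic n)) → Ω => h ⟨n, Finset.mem_Iic.2 le_rfl⟩)
            (measurable_pi_apply _))]
      = autocov κ π (fun y => f y - ∫ z, f z ∂π) (Nat.dist i j) := by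
  set P := Kernel.trajMeasure (X := fun _ : ℕ => Ω) π
        (fun n : ℕ => κ.comap (fun h : (i : ↥(Finset.Iic n)) → Ω => h ⟨n, Finset.mem_Iic.2 le_rfl⟩)
          (measurable_pi_apply _)) with hP
  set m := ∫ z, f z ∂π with hm
  have hmean : ∀ k, ∫ x, f (x k) ∂P = m := fun k => by rw [hP]; exact chain_marginal hπ k hf hC
  have hcm : Measurable fun y => f y - m := hf.sub measurable_const
  have hcb : ∀ y, |f y - m| ≤ C + |m| := fun y => (abs_sub _ _).trans (add_le_add (hC y) le_rfl)
  have hkey : ∀ a t : ℕ, ∫ x, (f (x a) - m) * (f (x (a + t)) - m) ∂P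
      = autocov κ π (fun y => f y - m) t := fun a t => by
    rw [hP]; exact chain_autocov hπ hcm hcb a t
  rw [ProbabilityTheory.covariance]
  simp only [hmean]
  rcases le_total i j with hij | hji
  · obtain ⟨t, rfl⟩ := Nat.exists_eq_add_of_le hij
    rw [Nat.dist_eq_sub_of_le hij, Nat.add_sub_cancel_left]
    exact hkey i t
  · obtain ⟨t, rfl⟩ := Nat.exists_eq_add_of_le hji
    rw [Nat.dist_eq_sub_of_le_right hji, Nat.add_sub_cancel_left, ← hkey j t]
    exact integral_congr_ae (ae_of_all _ fun x => mul_comm _ _)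

/-- Bounded observables of the chain are square integrable. -/
theorem chain_memLp (μ₀ : Measure Ω) [IsProbabilityMeasure μ₀] {f : Ω → ℝ} (hf : Measurable f)
    {C : ℝ} (hC : ∀ x, |f x| ≤ C) (i : ℕ) :
    MemLp (fun x : ℕ → Ω => f (x i)) 2 (Kernel.trajMeasure (X := fun _ : ℕ => Ω) μ₀
      (fun n : ℕ => κ.comap (fun h : (i : ↥(Finset.Iic n)) → Ω => h ⟨n, Finset.mem_Iic.2 le_rfl⟩)
        (measurable_pi_apply _))) :=
  MemLp.of_bound (hf.comp (measurable_pi_apply i)).aestronglyMeasurable C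
    (ae_of_all _ fun x => by rw [Real.norm_eq_abs]; exact hC (x i))

/-- **THE FIGURE OF MERIT IS THE VARIANCE OF THE TIME AVERAGE.**  For the stationary chain and
every bounded measurable `f` with `Var_π f ≠ 0`:
`Var[(1/N) Σ_{i<N} f(X_i)] = 2 τ_N(ρ_f) · Var_π f / N`, where `ρ_f(t) = autocov κ π (f − π f) t /
Var_π f` is the TRUE autocorrelation function and `τ_N` row 11's finite-`N` integrated
autocorrelation time (`Scoring.tauIntN`, `→ τ_int`). -/
theorem variance_timeAverage {π : Measure Ω} [IsProbabilityMeasure π] (hπ : Kernel.Invariant κ π)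
    {f : Ω → ℝ} (hf : Measurable f) {C : ℝ} (hC : ∀ x, |f x| ≤ C) {N : ℕ} (hN : N ≠ 0)
    (hvar : autocov κ π (fun y => f y - ∫ z, f z ∂π) 0 ≠ 0) :
    Var[fun x : ℕ → Ω => (∑ i ∈ Finset.range N, f (x i)) / N;
        Kernel.trajMeasure (X := fun _ : ℕ => Ω) π
          (fun n : ℕ => κ.comap (fun h : (i : ↥(Finset.Iic n)) → Ω => h ⟨n, Finset.mem_Iic.2 le_rfl⟩)
            (measurable_pi_apply _))]
      = 2 * tauIntN (fun t => autocov κ π (fun y => f y - ∫ z, f z ∂π) t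
            / autocov κ π (fun y => f y - ∫ z, f z ∂π) 0) N
          * autocov κ π (fun y => f y - ∫ z, f z ∂π) 0 / N := by
  refine variance_mean_range_of_cov_eq (fun i (x : ℕ → Ω) => f (x i))
    (autocov κ π (fun y => f y - ∫ z, f z ∂π) 0)
    (fun t => autocov κ π (fun y => f y - ∫ z, f z ∂π) t
      / autocov κ π (fun y => f y - ∫ z, f z ∂π) 0) (div_self hvar) hN
    (fun i _ => chain_memLp π hf hC i) fun i _ j _ => ?_
  rw [chain_covariance hπ hf hC i j, mul_div_cancel₀ _ hvar]

/-- **A certified non-asymptotic error bar**: if moreover `κ(x, ·) ≥ ε π` (Doeblin by the invariant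
law, `ε > 0`), then for every bounded measurable `f` and every `N ≥ 1`:
`Var[(1/N) Σ_{i<N} f(X_i)] ≤ (2/ε − 1) · Var_π f / N`. -/
theorem variance_timeAverage_le_of_doeblin {π : Measure Ω} [IsProbabilityMeasure π]
    (hπ : Kernel.Invariant κ π) {ε : ℝ≥0∞}
    (hmin : ∀ x {B : Set Ω}, MeasurableSet B → ε * π B ≤ κ x B) (hε0 : 0 < ε)
    {f : Ω → ℝ} (hf : Measurable f) {C : ℝ} (hC : ∀ x, |f x| ≤ C) {N : ℕ} (hN : N ≠ 0) :
    Var[fun x : ℕ → Ω => (∑ i ∈ Finset.range N, f (x i)) / N;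
        Kernel.trajMeasure (X := fun _ : ℕ => Ω) π
          (fun n : ℕ => κ.comap (fun h : (i : ↥(Finset.Iic n)) → Ω => h ⟨n, Finset.mem_Iic.2 le_rfl⟩)
            (measurable_pi_apply _))]
      ≤ (2 / ε.toReal - 1) * autocov κ π (fun y => f y - ∫ z, f z ∂π) 0 / N := by
  set P := Kernel.trajMeasure (X := fun _ : ℕ => Ω) π
        (fun n : ℕ => κ.comap (fun h : (i : ↥(Finset.Iic n)) → Ω => h ⟨n, Finset.mem_Iic.2 le_rfl⟩)
          (measurable_pi_apply _)) with hP
  set g := fun y => f y - ∫ z, f z ∂π with hg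
  have hgm : Measurable g := hf.sub measurable_const
  have hgb : ∀ y, |g y| ≤ C + |∫ z, f z ∂π| := fun y =>
    (abs_sub _ _).trans (add_le_add (hC y) le_rfl)
  have hg0 : ∫ y, g y ∂π = 0 := by
    rw [hg, integral_sub (integrable_of_bounded π hf hC) (integrable_const _), integral_const,
      probReal_univ, one_smul, sub_self]
  have hε1 := eps_le_one_of_doeblin hmin
  have hεr0 : 0 < ε.toReal :=
    ENNReal.toReal_pos hε0.ne' (ne_top_of_le_ne_top ENNReal.one_ne_top hε1)
  have hl0 : 0 ≤ 1 - ε.toReal := one_sub_toReal_nonneg_of_doeblin hmin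
  have hl1 : 1 - ε.toReal < 1 := by linarith
  have habs : |1 - ε.toReal| < 1 := by rw [abs_of_nonneg hl0]; exact hl1
  have hgeo := hasSum_geometric_succ habs
  have hσ0 : 0 ≤ autocov κ π g 0 := by rw [autocov_zero]; exact integral_nonneg fun _ => sq_nonneg _
  have henv : ∀ t, |autocov κ π g t| ≤ (1 - ε.toReal) ^ t * autocov κ π g 0 := fun t => by
    rw [autocov_zero]; exact abs_autocov_le_of_doeblin hπ hmin hgm hgb hg0 t
  have hsum : Var[fun x : ℕ → Ω => ∑ i ∈ Finset.range N, f (x i); P]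
      = N * autocov κ π g 0
          + 2 * ∑ t ∈ Finset.range N, ((N : ℝ) - (t + 1)) * autocov κ π g (t + 1) := by
    have h := variance_sum_range_of_cov_eq (μ := P) (fun i x => f (x i)) (autocov κ π g) N
      (fun i _ => by rw [hP]; exact chain_memLp π hf hC i)
      (fun i _ j _ => by rw [hP]; exact chain_covariance hπ hf hC i j)
    rw [← h]
    congr 1
    funext x
    rw [Finset.sum_apply]
  have hNpos : (0 : ℝ) < N := by exact_mod_cast Nat.pos_of_ne_zero hN
  have hlag : ∑ t ∈ Finset.range N, ((N : ℝ) - (t + 1)) * autocov κ π g (t + 1)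
      ≤ N * ((1 / ε.toReal - 1) * autocov κ π g 0) := by
    have hterm : ∀ t ∈ Finset.range N, ((N : ℝ) - (t + 1)) * autocov κ π g (t + 1)
        ≤ N * ((1 - ε.toReal) ^ (t + 1) * autocov κ π g 0) := by
      intro t ht
      have ht' : (t : ℝ) + 1 ≤ N := by exact_mod_cast Finset.mem_range.1 ht
      have h1 : ((N : ℝ) - (t + 1)) * autocov κ π g (t + 1)
          ≤ ((N : ℝ) - (t + 1)) * |autocov κ π g (t + 1)| :=
        mul_le_mul_of_nonneg_left (le_abs_self _) (by linarith)
      have h2 : ((N : ℝ) - (t + 1)) * |autocov κ π g (t + 1)| ≤ N * |autocov κ π g (t + 1)| :=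
        mul_le_mul_of_nonneg_right (by linarith) (abs_nonneg _)
      exact h1.trans (h2.trans (mul_le_mul_of_nonneg_left (henv (t + 1)) hNpos.le))
    refine (Finset.sum_le_sum hterm).trans ?_
    rw [← Finset.mul_sum, ← Finset.sum_mul]
    refine mul_le_mul_of_nonneg_left (mul_le_mul_of_nonneg_right ?_ hσ0) hNpos.le
    have hs := sum_le_hasSum (Finset.range N) (fun t _ => pow_nonneg hl0 (t + 1)) hgeo
    have hε' : (1 - ε.toReal) / (1 - (1 - ε.toReal)) = 1 / ε.toReal - 1 := by
      rw [sub_sub_cancel, sub_div, div_self hεr0.ne']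
    linarith
  have hdiv : (fun x : ℕ → Ω => (∑ i ∈ Finset.range N, f (x i)) / N)
      = fun x => (∑ i ∈ Finset.range N, f (x i)) * (N : ℝ)⁻¹ := by
    funext x; rw [div_eq_mul_inv]
  rw [hdiv, variance_mul_const, hsum]
  rw [show (2 / ε.toReal - 1) * autocov κ π g 0 / N
      = (N * autocov κ π g 0 + 2 * (N * ((1 / ε.toReal - 1) * autocov κ π g 0))) * ((N : ℝ)⁻¹) ^ 2 by
    field_simp; ring]
  exact mul_le_mul_of_nonneg_right (by linarith) (sq_nonneg _)

end Chain

end Summit.Ventures.LatticeQCDFlow.Scoring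

end
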